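import Summits.QuantumFields.YangMills.Theorems.ForcedResponseSkewnessRunningCouplingCeilingSmearClasses
import Summits.QuantumFields.YangMills.Theorems.PencilRigidityNPointIsotropyRiemannSum
import HarnessLib

/-!
# Crux `RunningCouplingCeiling` (repaired, stmt-QuantumFields-24275), line «pointwise-log-ceiling-r»: toolkit for the
# uniform smearing stub

Support file (`--supports stmt-QuantumFields-24275`, helper) of the lead prover of route `ForcedResponseSkewness` (unit
`ym-line-frs-p1`):

* `abs_sub_le_seminorm_mul` — a Schwartz function is Lipschitz with constant its `(0,1)` seminorm;
* `riemann_abs_le_two` — for a real Schwartz `g` on `ℝ⁴` supported in `closedBall 0 R` with `∫|g| ≤ 1`: for every mesh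
  `0 < a ≤ a₀(g)` and EVERY box, `a⁴ Σ_{y ∈ box L} |g(a y)| ≤ 2` (the lattice step function of `|g|` is dominated by
  `|g| + 4Da·1_{closedBall 0 (R+4)}`; cell toolkit of `Theorems/PencilRigidityNPointIsotropyRiemannSum.lean`);
* `support_geometry` — a source in `closedBall p ρ₀` has time in `[p₀−ρ₀, p₀+ρ₀]` and norm `≤ ‖p‖ + ρ₀` on its support;
* `integral_abs_thetaTest` — `∫|θv| = ∫|v|` (time reflection preserves Lebesgue measure);
* `window_kernel_le` — the window-class kernel estimate `|k| ≤ (4C₀⁺ + C₁⁺ log²(4R²+2)) (s/σ₀)⁸ / log²Λ`.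

Honest label: bookkeeping for a conditional rung line (leaf R2a `BalabanLadder.NT`); nothing here bears on the Yang–Mills
mass gap, which is NOT proved by this.
-/

set_option autoImplicit false

noncomputable section

namespace Summit.QuantumFields.YangMills.Cruxes.RunningCouplingCeiling.Pointwise

open Set Metric MeasureTheory Filter Topology Finset
open scoped SchwartzMap
open Literature.MathematicalPhysics.QuantumLattice Literature.Probability.LatticeModels
open Summit.QuantumFields.YangMills.Theorems.NPointIsotropy.ComplexRotationBandlimit
  (integral_step step_apply norm_sub_floor_le integrable_step)

/-! ### Riemann sums of `|g|` for a compactly supported Schwartz function: a uniform bound for small mesh -/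

/-- A Schwartz function is Lipschitz with constant its `(0,1)` seminorm. [folklore] -/
theorem abs_sub_le_seminorm_mul (g : 𝓢(EuclideanSpace ℝ (Fin 4), ℝ)) (x y : EuclideanSpace ℝ (Fin 4)) :
    |g x - g y| ≤ SchwartzMap.seminorm ℝ 0 1 g * ‖x - y‖ := by
  have hb : ∀ z ∈ (Set.univ : Set (EuclideanSpace ℝ (Fin 4))),
      ‖fderiv ℝ (g : EuclideanSpace ℝ (Fin 4) → ℝ) z‖ ≤ SchwartzMap.seminorm ℝ 0 1 g := fun z _ => by
    have h := SchwartzMap.le_seminorm ℝ 0 1 g z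
    rwa [pow_zero, one_mul, norm_iteratedFDeriv_one] at h
  have h := convex_univ.norm_image_sub_le_of_norm_fderiv_le (fun z _ => g.differentiableAt) hb
    (Set.mem_univ y) (Set.mem_univ x)
  rwa [Real.norm_eq_abs] at h

/-- **Riemann sums of `|g|`, uniform bound for small mesh.**  If `g` is a real Schwartz function on `ℝ⁴` supported in
`closedBall 0 R` with `∫|g| ≤ 1`, then for every mesh `0 < a ≤ a₀(g)` and EVERY box,
`a⁴ Σ_{y ∈ box L} |g(a y)| ≤ 2` (the lattice step function of `|g|` is at most `|g| + 4Da·1_{closedBall 0 (R+4)}`,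
`D` the Lipschitz constant). [folklore] -/
theorem riemann_abs_le_two (g : 𝓢(EuclideanSpace ℝ (Fin 4), ℝ)) {R : ℝ}
    (hsupp : ∀ z, g z ≠ 0 → ‖z‖ ≤ R) (hL1 : (∫ z, |g z|) ≤ 1) :
    ∃ a₀ : ℝ, 0 < a₀ ∧ ∀ a : ℝ, 0 < a → a ≤ a₀ → ∀ L : ℕ,
      a ^ 4 * ∑ y ∈ box 4 L, |g (a • siteToE y)| ≤ 2 := by
  set D : ℝ := SchwartzMap.seminorm ℝ 0 1 g with hD
  have hD0 : 0 ≤ D := apply_nonneg _ _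
  set V : ℝ := (volume : Measure (EuclideanSpace ℝ (Fin 4))).real
    (closedBall (0 : EuclideanSpace ℝ (Fin 4)) (R + 4)) with hV
  have hV0 : 0 ≤ V := measureReal_nonneg
  refine ⟨1 / (4 * D * V + 1), by positivity, fun a ha ha₀ L => ?_⟩
  have hDV : 0 ≤ 4 * D * V := by positivity
  have ha1 : a ≤ 1 := ha₀.trans (by rw [div_le_one (by positivity)]; linarith)
  have haDV : V * (4 * D * a) ≤ 1 := by
    have h1 : V * (4 * D * a) = (4 * D * V) * a := by ring
    rw [h1]
    calc (4 * D * V) * a ≤ (4 * D * V) * (1 / (4 * D * V + 1)) := mul_le_mul_of_nonneg_left ha₀ hDV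
      _ = (4 * D * V) / (4 * D * V + 1) := by rw [mul_one_div]
      _ ≤ 1 := div_le_one_of_le₀ (by linarith) (by positivity)
  -- the Riemann sum is the integral of the lattice step function of `|g|`
  rw [← integral_step (fun z => |g z|) ha.le L]
  -- pointwise domination of the step function
  have hpt : ∀ x : EuclideanSpace ℝ (Fin 4),
      (∑ y ∈ box 4 L, {z : EuclideanSpace ℝ (Fin 4) |
          ∀ i, z i ∈ Set.Ico (a * (y i : ℝ)) (a * (y i : ℝ) + a)}.indicator (fun _ => |g (a • siteToE y)|) x) ≤
        |g x| + (closedBall (0 : EuclideanSpace ℝ (Fin 4)) (R + 4)).indicator (fun _ => 4 * D * a) x := by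
    intro x
    have hind0 : 0 ≤ (closedBall (0 : EuclideanSpace ℝ (Fin 4)) (R + 4)).indicator (fun _ => 4 * D * a) x :=
      Set.indicator_nonneg (fun _ _ => by positivity) _
    rw [step_apply (fun z => |g z|) ha L x]
    split_ifs with hmem
    · set z : EuclideanSpace ℝ (Fin 4) := a • siteToE (fun i => ⌊x i / a⌋) with hz
      by_cases hgz : g z = 0
      · rw [hgz, abs_zero]; exact add_nonneg (abs_nonneg _) hind0
      · have hzR : ‖z‖ ≤ R := hsupp z hgz
        have hxz : ‖x - z‖ ≤ 4 * a := by
          have h := norm_sub_floor_le ha x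
          have h4 : ((4 : ℕ) : ℝ) * a = 4 * a := by norm_num
          rw [h4] at h
          exact h
        have hxball : x ∈ closedBall (0 : EuclideanSpace ℝ (Fin 4)) (R + 4) := by
          rw [mem_closedBall, dist_zero_right]
          calc ‖x‖ = ‖(x - z) + z‖ := by rw [sub_add_cancel]
            _ ≤ ‖x - z‖ + ‖z‖ := norm_add_le _ _
            _ ≤ 4 * a + R := add_le_add hxz hzR
            _ ≤ R + 4 := by linarith
        rw [Set.indicator_of_mem hxball]
        have hlip := abs_sub_le_seminorm_mul g z x
        have hzx : ‖z - x‖ ≤ 4 * a := by rw [norm_sub_rev]; exact hxz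
        have htri : |g z| ≤ |g x| + |g z - g x| := by
          have := abs_sub_abs_le_abs_sub (g z) (g x); linarith
        calc |g z| ≤ |g x| + |g z - g x| := htri
          _ ≤ |g x| + D * (4 * a) := by
              have : |g z - g x| ≤ D * (4 * a) := hlip.trans (mul_le_mul_of_nonneg_left hzx hD0)
              linarith
          _ = |g x| + 4 * D * a := by ring
    · exact add_nonneg (abs_nonneg _) hind0
  have hfin : volume (closedBall (0 : EuclideanSpace ℝ (Fin 4)) (R + 4)) < ⊤ := measure_closedBall_lt_top
  have hint_ind : Integrable (fun x : EuclideanSpace ℝ (Fin 4) =>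
      (closedBall (0 : EuclideanSpace ℝ (Fin 4)) (R + 4)).indicator (fun _ => 4 * D * a) x) :=
    (integrableOn_const hfin.ne).integrable_indicator measurableSet_closedBall
  have hint_abs : Integrable (fun x : EuclideanSpace ℝ (Fin 4) => |g x|) := g.integrable.abs
  calc ∫ x, ∑ y ∈ box 4 L, {z : EuclideanSpace ℝ (Fin 4) |
          ∀ i, z i ∈ Set.Ico (a * (y i : ℝ)) (a * (y i : ℝ) + a)}.indicator (fun _ => |g (a • siteToE y)|) x
      ≤ ∫ x, (|g x| + (closedBall (0 : EuclideanSpace ℝ (Fin 4)) (R + 4)).indicator (fun _ => 4 * D * a) x) :=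
        integral_mono (integrable_step (fun z => |g z|) ha.le L) (hint_abs.add hint_ind) hpt
    _ = (∫ x, |g x|) + ∫ x, (closedBall (0 : EuclideanSpace ℝ (Fin 4)) (R + 4)).indicator (fun _ => 4 * D * a) x :=
        integral_add hint_abs hint_ind
    _ = (∫ x, |g x|) + V * (4 * D * a) := by
        rw [integral_indicator_const _ measurableSet_closedBall, smul_eq_mul]
    _ ≤ 1 + 1 := add_le_add hL1 haDV
    _ = 2 := by norm_num

/-! ### Support geometry of a source in a positive-time ball -/

/-- A point of the support of a source in `closedBall p ρ₀` has time in `[p₀ − ρ₀, p₀ + ρ₀]` and norm `≤ ‖p‖ + ρ₀`. [folklore] -/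
theorem support_geometry {v : 𝓢(EuclideanSpace ℝ (Fin 4), ℝ)} {p : EuclideanSpace ℝ (Fin 4)} {ρ₀ : ℝ}
    (hv : tsupport (v : EuclideanSpace ℝ (Fin 4) → ℝ) ⊆ closedBall p ρ₀) {w : EuclideanSpace ℝ (Fin 4)}
    (hw : v w ≠ 0) : p 0 - ρ₀ ≤ w 0 ∧ w 0 ≤ p 0 + ρ₀ ∧ ‖w‖ ≤ ‖p‖ + ρ₀ := by
  have hball : w ∈ closedBall p ρ₀ := hv (subset_tsupport _ hw)
  rw [mem_closedBall, dist_eq_norm] at hball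
  have h0 : |(w - p) 0| ≤ ρ₀ := by
    have h := PiLp.norm_apply_le (w - p) (0 : Fin 4)
    rw [Real.norm_eq_abs] at h
    exact h.trans hball
  rw [PiLp.sub_apply, abs_le] at h0
  refine ⟨by linarith [h0.1], by linarith [h0.2], ?_⟩
  calc ‖w‖ = ‖(w - p) + p‖ := by rw [sub_add_cancel]
    _ ≤ ‖w - p‖ + ‖p‖ := norm_add_le _ _
    _ ≤ ‖p‖ + ρ₀ := by linarith

/-- `∫ |θv| = ∫ |v|` (time reflection preserves Lebesgue measure). [folklore] -/
theorem integral_abs_thetaTest (v : 𝓢(EuclideanSpace ℝ (Fin 4), ℝ)) :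
    (∫ z, |(thetaTest 4 v) z|) = ∫ z, |v z| := by
  simp_rw [thetaTest_apply]
  exact (timeReflection 4).measurePreserving.integral_comp (timeReflection 4).toHomeomorph.measurableEmbedding
    (fun z => |v z|)

/-! ### The window estimate (pure real arithmetic) -/

/-- WINDOW class for the uniform smearing: with `d s ≤ 2R`, `Λ ≤ l`, `s = l t`: if `Λ ≥ Λ* = 4R² + 2` then `t d ≤ 1/√Λ` and
the running-coupling clause gives `|k| ≤ 4C₀(s/σ₀)⁸/log²Λ`; otherwise the scale-free bound `C₁(s/σ₀)⁸` is at most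
`C₁(s/σ₀)⁸ log²Λ*/log²Λ`.  Either way `|k| ≤ W (s/σ₀)⁸/log²Λ`, `W = 4C₀⁺ + C₁⁺ log²Λ*`. [folklore] -/
theorem window_kernel_le {Λ R t d s σ₀ C₀ C₀' C₁' k l : ℝ} (hΛ : 2 ≤ Λ) (hR0 : 0 ≤ R) (ht : 0 < t) (hd : 0 < d)
    (hl1 : Λ ≤ l) (hs : s = l * t) (hduw : d * s ≤ 2 * R) (hσ₀ : 0 < σ₀) (hσd : σ₀ ≤ s * d)
    (hK0 : d ^ 8 * |k| ≤ C₀ / Real.log (1 / (t * d)) ^ 2) (hC : C₀ ≤ C₀')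
    (hC0 : 0 ≤ C₀') (hC1 : 0 ≤ C₁') (hsf : |k| ≤ C₁' * (s / σ₀) ^ 8) :
    |k| ≤ (4 * C₀' + C₁' * Real.log (4 * R ^ 2 + 2) ^ 2) * (s / σ₀) ^ 8 / Real.log Λ ^ 2 := by
  have hΛpos : 0 < Λ := by linarith
  have hlog : 0 < Real.log Λ := Real.log_pos (by linarith)
  rcases le_or_gt (4 * R ^ 2 + 2) Λ with hbig | hsmall
  · -- `t d ≤ 1/√Λ`
    have hsqrt : 0 < Real.sqrt Λ := Real.sqrt_pos.2 hΛpos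
    have hsq : Real.sqrt Λ * Real.sqrt Λ = Λ := Real.mul_self_sqrt hΛpos.le
    have htdΛ : t * d ≤ 1 / Real.sqrt Λ := by
      have h1 : t * d * l ≤ 2 * R := by
        calc t * d * l = d * s := by rw [hs]; ring
          _ ≤ 2 * R := hduw
      have h2 : t * d * Λ ≤ t * d * l := mul_le_mul_of_nonneg_left hl1 (mul_pos ht hd).le
      have h4R : (2 * R) ^ 2 ≤ Λ := by nlinarith
      have hRs : 2 * R ≤ Real.sqrt Λ := by
        rw [show 2 * R = Real.sqrt ((2 * R) ^ 2) by rw [Real.sqrt_sq (by positivity)]]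
        exact Real.sqrt_le_sqrt h4R
      have h2R : 2 * R * Real.sqrt Λ ≤ Λ := by
        calc 2 * R * Real.sqrt Λ ≤ Real.sqrt Λ * Real.sqrt Λ := mul_le_mul_of_nonneg_right hRs hsqrt.le
          _ = Λ := hsq
      rw [le_div_iff₀ hsqrt]
      have h4 : t * d * Real.sqrt Λ * Λ ≤ 1 * Λ := by
        calc t * d * Real.sqrt Λ * Λ = t * d * Λ * Real.sqrt Λ := by ring
          _ ≤ 2 * R * Real.sqrt Λ := mul_le_mul_of_nonneg_right (h2.trans h1) hsqrt.le
          _ ≤ Λ := h2R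
          _ = 1 * Λ := (one_mul _).symm
      exact le_of_mul_le_mul_right h4 hΛpos
    have htdpos : 0 < t * d := mul_pos ht hd
    have hinv : Real.sqrt Λ ≤ 1 / (t * d) := (le_one_div hsqrt htdpos).2 htdΛ
    have hlog1 : Real.log Λ / 2 ≤ Real.log (1 / (t * d)) := by
      rw [← Real.log_sqrt hΛpos.le]; exact Real.log_le_log hsqrt hinv
    have hlog2 : Real.log Λ ^ 2 / 4 ≤ Real.log (1 / (t * d)) ^ 2 := by
      have h0 : 0 ≤ Real.log Λ / 2 := by positivity
      calc Real.log Λ ^ 2 / 4 = (Real.log Λ / 2) ^ 2 := by ring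
        _ ≤ Real.log (1 / (t * d)) ^ 2 := pow_le_pow_left₀ h0 hlog1 2
    have hk' : d ^ 8 * |k| ≤ 4 * C₀' / Real.log Λ ^ 2 := by
      calc d ^ 8 * |k| ≤ C₀ / Real.log (1 / (t * d)) ^ 2 := hK0
        _ ≤ C₀' / Real.log (1 / (t * d)) ^ 2 := div_le_div_of_nonneg_right hC (sq_nonneg _)
        _ ≤ C₀' / (Real.log Λ ^ 2 / 4) := div_le_div_of_nonneg_left hC0 (by positivity) hlog2
        _ = 4 * C₀' / Real.log Λ ^ 2 := by rw [div_div_eq_mul_div]; ring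
    have hkw : |k| ≤ 4 * C₀' / Real.log Λ ^ 2 * (s / σ₀) ^ 8 :=
      kernel_le_of_pow_mul_le hd hσ₀ hσd (by positivity) hk'
    have hW4 : 4 * C₀' ≤ 4 * C₀' + C₁' * Real.log (4 * R ^ 2 + 2) ^ 2 :=
      le_add_of_nonneg_right (by positivity)
    calc |k| ≤ 4 * C₀' / Real.log Λ ^ 2 * (s / σ₀) ^ 8 := hkw
      _ = (4 * C₀') * (s / σ₀) ^ 8 / Real.log Λ ^ 2 := by ring
      _ ≤ (4 * C₀' + C₁' * Real.log (4 * R ^ 2 + 2) ^ 2) * (s / σ₀) ^ 8 / Real.log Λ ^ 2 :=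
          div_le_div_of_nonneg_right (mul_le_mul_of_nonneg_right hW4 (by positivity)) (sq_nonneg _)
  · -- small window: `log Λ ≤ log Λ*`
    have hll : Real.log Λ ≤ Real.log (4 * R ^ 2 + 2) := Real.log_le_log hΛpos hsmall.le
    have hll2 : Real.log Λ ^ 2 ≤ Real.log (4 * R ^ 2 + 2) ^ 2 := pow_le_pow_left₀ hlog.le hll 2
    have hWC : C₁' * Real.log (4 * R ^ 2 + 2) ^ 2 ≤ 4 * C₀' + C₁' * Real.log (4 * R ^ 2 + 2) ^ 2 :=
      le_add_of_nonneg_left (by positivity)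
    calc |k| ≤ C₁' * (s / σ₀) ^ 8 := hsf
      _ = C₁' * (s / σ₀) ^ 8 * Real.log Λ ^ 2 / Real.log Λ ^ 2 :=
          (mul_div_cancel_right₀ _ (pow_ne_zero 2 hlog.ne')).symm
      _ ≤ C₁' * (s / σ₀) ^ 8 * Real.log (4 * R ^ 2 + 2) ^ 2 / Real.log Λ ^ 2 :=
          div_le_div_of_nonneg_right (mul_le_mul_of_nonneg_left hll2 (by positivity)) (sq_nonneg _)
      _ = (C₁' * Real.log (4 * R ^ 2 + 2) ^ 2) * (s / σ₀) ^ 8 / Real.log Λ ^ 2 := by ring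
      _ ≤ (4 * C₀' + C₁' * Real.log (4 * R ^ 2 + 2) ^ 2) * (s / σ₀) ^ 8 / Real.log Λ ^ 2 :=
          div_le_div_of_nonneg_right (mul_le_mul_of_nonneg_right hWC (by positivity)) (sq_nonneg _)

end Summit.QuantumFields.YangMills.Cruxes.RunningCouplingCeiling.Pointwise

end
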